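import Summits.CriticalPhenomena.PercolationContinuityZ3.Theorems.PercNearOneGluingNoHeavyLowerTailSunflowerMultiPetalKempeMarkedTIDefs
import HarnessLib
import HarnessLib.Audit

/-!
# `NoHeavyLowerTail` (crux stmt-CriticalPhenomena-4575), marked multigraphs, THEOREM TI2: the WEIGHTED CELLS of the vertex-deletion step for the
# terminal-weighted functional `TI` — one-point expansion, cell identity, contraction bookkeeping, the marked-vertex case and the degree-0 identity

Support file (seat `prim-l12-p2` gen 52; `--supports stmt-CriticalPhenomena-4575`; continuation of `…KempeMarkedTIDefs`).  No `sorry`; nothing is asserted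
about the crux.  Memo: run/shared/lean/prim/prim-l12/prim-l12-p2/FINDING-g51-TI-HIERARCHY.md §9, PROOF-TI2-MARKED-MULTIGRAPHS-g51.md §1, §3.

For the weight colour `c ∈ {0,1}` write `K⁺ = K.addMark (wterm c u v) 1` (one more mark at the `c`-coloured terminal).  A colouring `ρ` with `ρ s = c` is a
`K⁺`-CELL (weight `1`), any other colouring a `K`-CELL (weight `2`); all of g47's cell machinery (p595450 `resCell`, p595201 one-point expansion) is applied to
`K` and to `K⁺` and glued along the colour of `s`:
* `WK` (weighted one-point kernel), `resW` (weighted cell residual `= [ρ s = c]·resCell_{K⁺} + [ρ s ≠ c]·2·resCell_K`), `AZW` (weighted all-`0` sum);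
* `sum_WK_eq` — `Σ_ρ WK = 3·TI(K) − TI(K.isolate y)`;  **`sum_resW_eq`** — THE WEIGHTED CELL IDENTITY `Σ_ρ resW = 3·TI(K) − TI(K.isolate y) − AZW`;
* `pow_mul_AZW_eq_TIfun` (`s ∉ S`: `3^{|S|}·AZW = TI(K.peelContract y S u)`), `pow_mul_AZW_eq_of_mem_zero/one` (`s ∈ S`: `3^{|S|}·AZW` is `T` of
  `(K⁺ᵘ).peelContract y S u`, resp. twice `T(K.peelContract y S u)` — the merged special vertex is the terminal itself);
* **`TIfun_isolate_le_of_mark`** — memo §9 (a): a MARKED non-terminal `y ≠ s` is deleted monotonically, `TI(K.isolate y) ≤ 3·TI(K)`;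
* **`three_mul_TIfun_eq_of_pendant`** — memo §9 (e), `d = 0`: for an unmarked `y ∼ u` with `N(y) ⊆ {u,v}` the EXACT identity
  `3·TI(K) = TI(K') + TI(K' + A marks at u) + TI(K' + B marks at v)` (`K' = K.isolate y`, `A = mul y u`, `B = mul y v`).
-/

namespace Summit.CriticalPhenomena.PercolationContinuityZ3.Theorems.SunflowerPartition.Kempe

open Finset

/-! ## Capped-type algebra (finite checks) -/

/-- Right-commutation of capped addition of types. (finite check) [this work] -/
theorem ctAdd_right_comm : ∀ t x e : CType, ctAdd (ctAdd t x) e = ctAdd (ctAdd t e) x := by decide +kernel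

/-- The two-terminal one-point kernel at a profile with no third colour splits into the two marked types. (finite check) [this work] -/
theorem kerTAbs_profile_no_two : ∀ (t : CType) (a b : Fin 3), kerTAbs t (a, b, 0) = fC (ctAdd t (a, 0, 0)) + fC (ctAdd t (0, b, 0)) := by
  decide +kernel

/-- `xPart 0 (m,m,m) = (m,0,0)`. (finite check) [this work] -/
theorem xPart_zero_diag : ∀ m : Fin 3, xPart 0 (m, m, m) = (m, 0, 0) := by decide
/-- `xPart 1 (m,m,m) = (0,m,0)`. (finite check) [this work] -/
theorem xPart_one_diag : ∀ m : Fin 3, xPart 1 (m, m, m) = (0, m, 0) := by decide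

namespace MGraph

variable {V : Type*} [Fintype V] [LinearOrder V] (K : MGraph V)

/-! ## Small bookkeeping: marks commute with isolating another vertex and do not change profiles -/

section Bookkeeping

omit [Fintype V] in
/-- Adding marks at `w ≠ y` commutes with isolating `y`. [this work] -/
theorem isolate_addMark (w y : V) (hwy : w ≠ y) (m : ℕ) : (K.addMark w m).isolate y = (K.isolate y).addMark w m := by
  refine ext' (fun a b => ?_) (fun a => ?_)
  · unfold addMark addAtU isolate
    by_cases h : a = y ∨ b = y
    · simp [h]
    · simp [h]
  · unfold addMark addAtU isolate
    by_cases h : a = y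
    · simp [h, hwy.symm]
    · simp [h]

/-- Adding marks at `w ≠ y` does not change the profile of `y`. [this work] -/
theorem profM_addMark (w y : V) (hwy : w ≠ y) (m : ℕ) (ρ : V → Fin 3) : (K.addMark w m).profM y ρ = K.profM y ρ := by
  have hl : ∀ d, (K.addMark w m).linkM y ρ d = K.linkM y ρ d := by
    intro d
    unfold linkM addMark addAtU
    refine sum_congr rfl fun x _ => ?_
    simp
  unfold profM
  rw [hl 0, hl 1, hl 2]
  unfold addMark addAtU
  simp [hwy.symm]

/-- The weight terminal: `u` for weight colour `0`, `v` otherwise. [this work] -/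
def wterm (c : Fin 3) (u v : V) : V := if c = 0 then u else v

omit [Fintype V] [LinearOrder V] in
/-- A terminal-coloured colouring gives the weight terminal the weight colour (`c ∈ {0,1}`). [this work] -/
theorem apply_wterm (c : Fin 3) (hc : c = 0 ∨ c = 1) (u v : V) (ρ : V → Fin 3) (hu : ρ u = 0) (hv : ρ v = 1) : ρ (wterm c u v) = c := by
  unfold wterm
  rcases hc with h | h
  · subst h; rw [if_pos rfl, hu]
  · subst h; rw [if_neg (by decide), hv]

omit [Fintype V] [LinearOrder V] in
/-- The weight terminal is a terminal. [this work] -/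
theorem wterm_eq_or (c : Fin 3) (u v : V) : wterm c u v = u ∨ wterm c u v = v := by
  unfold wterm; split_ifs
  · exact Or.inl rfl
  · exact Or.inr rfl

/-- The cell residual of `K⁺ = K.addMark w 1` (`w ≠ y`) in terms of `K`'s type and profile: the type is shifted by `e_{ρ w}`. [this work] -/
theorem resCell_addMark (w y : V) (hwy : w ≠ y) (S : Finset V) (ρ : V → Fin 3) :
    (K.addMark w 1).resCell y S ρ
      = kerTAbs (ctAdd ((K.isolate y).ctypeM ρ) (xPart (ρ w) (1, 1, 1))) (K.profM y ρ)
        - (if ∀ s ∈ S, ρ s = 0 then fC (ctAdd ((K.isolate y).ctypeM ρ) (xPart (ρ w) (1, 1, 1))) else 0) := by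
  unfold resCell
  rw [K.isolate_addMark w y hwy 1, (K.isolate y).ctypeM_addMark w 1 ρ, K.profM_addMark w y hwy 1 ρ, cap3_one_triple]

end Bookkeeping

/-! ## Weighted cells -/

section WCells

variable (c : Fin 3) (y : V) (S : Finset V) (s u v : V)

/-- The WEIGHTED ONE-POINT KERNEL at `y`: `Σ_{c'} hWt c (type_K ρ[y ↦ c']) (ρ s) − hWt c (type_{K−y} ρ) (ρ s)`. [this work] -/
def WK (ρ : V → Fin 3) : ℤ :=
  (∑ c' : Fin 3, hWt c (K.ctypeM (Function.update ρ y c')) (ρ s)) - hWt c ((K.isolate y).ctypeM ρ) (ρ s)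

/-- The WEIGHTED CELL RESIDUAL of the law `TI(K) ≥ TI(K−y) + TI((K−y)/(S∪u))`: a `K⁺`-cell (`ρ s = c`, weight `1`) or a `K`-cell (weight `2`). [this work] -/
def resW (ρ : V → Fin 3) : ℤ :=
  if ρ s = c then (K.addMark (wterm c u v) 1).resCell y S ρ else 2 * K.resCell y S ρ

/-- The WEIGHTED ALL-`0` SUM `Σ_{ρ u = 0, ρ v = 1} [ρ ≡ 0 on S]·hWt c (type_{K−y} ρ) (ρ s)`. [this work] -/
def AZW : ℤ :=
  ∑ ρ ∈ univ.filter (fun ρ : V → Fin 3 => ρ u = 0 ∧ ρ v = 1),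
    (if ∀ s' ∈ S, ρ s' = 0 then hWt c ((K.isolate y).ctypeM ρ) (ρ s) else 0)

variable {c y S s u v}

/-- The weighted one-point kernel in closed form: `kerTAbs` at the shifted type (`K⁺`-cell) or twice `kerTAbs` (`K`-cell). [this work] -/
theorem WK_eq (ρ : V → Fin 3) :
    K.WK c y s ρ = if ρ s = c then kerTAbs (ctAdd ((K.isolate y).ctypeM ρ) (xPart c (1, 1, 1))) (K.profM y ρ)
      else 2 * kerTAbs ((K.isolate y).ctypeM ρ) (K.profM y ρ) := by
  have ht : ∀ c' : Fin 3, K.ctypeM (Function.update ρ y c') = ctAdd ((K.isolate y).ctypeM ρ) (xPart c' (K.profM y ρ)) := by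
    intro c'
    rw [K.ctypeM_eq_ctAdd_isolate y (Function.update ρ y c'), Function.update_self, K.ctypeM_isolate_update y ρ c', K.profM_update_self y ρ c']
  unfold WK
  rw [Fin.sum_univ_three, ht 0, ht 1, ht 2]
  unfold hWt kerTAbs
  by_cases h : ρ s = c
  · simp only [if_pos h]
    rw [ctAdd_right_comm _ (xPart 0 _), ctAdd_right_comm _ (xPart 1 _), ctAdd_right_comm _ (xPart 2 _)]
  · simp only [if_neg h]
    ring

/-- The weighted cell residual in closed form: `WK − [ρ ≡ 0 on S]·hWt c (type_{K−y} ρ) (ρ s)` (for `ρ` giving the weight terminal the weight colour). [this work] -/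
theorem resW_eq (hc : c = 0 ∨ c = 1) (hyu : y ≠ u) (hyv : y ≠ v) (ρ : V → Fin 3) (hu : ρ u = 0) (hv : ρ v = 1) :
    K.resW c y S s u v ρ = K.WK c y s ρ - (if ∀ s' ∈ S, ρ s' = 0 then hWt c ((K.isolate y).ctypeM ρ) (ρ s) else 0) := by
  have hw : ρ (wterm c u v) = c := apply_wterm c hc u v ρ hu hv
  have hwy : wterm c u v ≠ y := by
    rcases wterm_eq_or c u v with h | h
    · rw [h]; exact hyu.symm
    · rw [h]; exact hyv.symm
  rw [K.WK_eq ρ]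
  unfold resW hWt
  by_cases h : ρ s = c
  · simp only [if_pos h]
    rw [K.resCell_addMark _ y hwy S ρ, hw]
  · simp only [if_neg h]
    unfold resCell
    split_ifs <;> ring

/-- **Weighted one-point expansion**: `Σ_ρ WK = 3·TI(K) − TI(K.isolate y)` over the terminal-coloured colourings (`y ∉ {u,v,s}`). [this work] -/
theorem sum_WK_eq (hys : y ≠ s) (hyu : y ≠ u) (hyv : y ≠ v) :
    ∑ ρ ∈ univ.filter (fun ρ : V → Fin 3 => ρ u = 0 ∧ ρ v = 1), K.WK c y s ρ = 3 * K.TIfun c s u v - (K.isolate y).TIfun c s u v := by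
  unfold WK TIfun
  rw [sum_sub_distrib, sum_comm]
  have h3 : ∀ c' : Fin 3, ∑ ρ ∈ univ.filter (fun ρ : V → Fin 3 => ρ u = 0 ∧ ρ v = 1), hWt c (K.ctypeM (Function.update ρ y c')) (ρ s)
      = 3 * ∑ ρ ∈ univ.filter (fun ρ : V → Fin 3 => ρ u = 0 ∧ ρ v = 1), (if ρ y = c' then hWt c (K.ctypeM ρ) (ρ s) else 0) := by
    intro c'
    have := sum_update_eq_three_mul_col y u v hyu.symm hyv.symm c' (fun σ => hWt c (K.ctypeM σ) (σ s))
    simp only [Function.update_of_ne hys.symm] at this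
    exact this
  simp only [h3]
  rw [← mul_sum, sum_comm]
  congr 1
  congr 1
  refine sum_congr rfl fun ρ _ => ?_
  rw [sum_ite_eq univ (ρ y), if_pos (mem_univ _)]

/-- **THE WEIGHTED CELL IDENTITY**: `Σ_ρ resW = 3·TI(K) − TI(K.isolate y) − AZW` (`c ∈ {0,1}`, `y ∉ {u,v,s}`). [this work] -/
theorem sum_resW_eq (hc : c = 0 ∨ c = 1) (hys : y ≠ s) (hyu : y ≠ u) (hyv : y ≠ v) :
    ∑ ρ ∈ univ.filter (fun ρ : V → Fin 3 => ρ u = 0 ∧ ρ v = 1), K.resW c y S s u v ρ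
      = 3 * K.TIfun c s u v - (K.isolate y).TIfun c s u v - K.AZW c y S s u v := by
  rw [← K.sum_WK_eq hys hyu hyv]
  unfold AZW
  rw [← sum_sub_distrib]
  refine sum_congr rfl fun ρ hρ => ?_
  obtain ⟨hu, hv⟩ := (mem_filter.1 hρ).2
  exact K.resW_eq hc hyu hyv ρ hu hv

end WCells

/-! ## Contraction bookkeeping for the weighted all-`0` sum -/

section WContract

/-- `sum_peelContract_eq` for an integrand that also reads the colour of a vertex `s` outside `S`:
`Σ_ρ [ρ ≡ 0 on T]·g(type_{peelContract} ρ, ρ s) = 3^{|S|}·Σ_ρ [ρ ≡ 0 on S ∪ T]·g(type_{K−y} ρ, ρ s)`. [this work] -/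
theorem sum_peelContract_eq_col (g : CType → Fin 3 → ℤ) (y u s : V) (S : Finset V) (huy : u ≠ y) (huS : u ∉ S) (hyS : y ∉ S) (v : V) (hvS : v ∉ S)
    (hsS : s ∉ S) :
    ∀ T : Finset V, Disjoint S T →
      ∑ ρ ∈ univ.filter (fun ρ : V → Fin 3 => ρ u = 0 ∧ ρ v = 1), (if ∀ t ∈ T, ρ t = 0 then g ((K.peelContract y S u).ctypeM ρ) (ρ s) else 0)
        = 3 ^ S.card * ∑ ρ ∈ univ.filter (fun ρ : V → Fin 3 => ρ u = 0 ∧ ρ v = 1),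
            (if ∀ t ∈ S ∪ T, ρ t = 0 then g ((K.isolate y).ctypeM ρ) (ρ s) else 0) := by
  induction S using Finset.induction_on with
  | empty =>
    intro T _
    rw [peelContract_empty, card_empty, pow_zero, one_mul]
    refine sum_congr rfl fun ρ _ => ?_
    simp
  | @insert s' S hs ih =>
    intro T hT
    have hsu : s' ≠ u := fun e => huS (e ▸ mem_insert_self s' S)
    have hsy : s' ≠ y := fun e => hyS (e ▸ mem_insert_self s' S)
    have hsv : s' ≠ v := fun e => hvS (e ▸ mem_insert_self s' S)
    have hss : s' ≠ s := fun e => hsS (e ▸ mem_insert_self s' S)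
    have huS' : u ∉ S := fun h => huS (mem_insert_of_mem h)
    have hyS' : y ∉ S := fun h => hyS (mem_insert_of_mem h)
    have hvS' : v ∉ S := fun h => hvS (mem_insert_of_mem h)
    have hsS' : s ∉ S := fun h => hsS (mem_insert_of_mem h)
    have hsT : s' ∉ T := fun h => (disjoint_left.1 hT) (mem_insert_self s' S) h
    have hST : Disjoint S (insert s' T) := by
      rw [disjoint_insert_right]; exact ⟨hs, (disjoint_insert_left.1 hT).2⟩
    rw [K.peelContract_insert y u S s' hs hsu hsy huS' huy, card_insert_of_notMem hs, pow_succ]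
    have step1 : ∀ ρ ∈ univ.filter (fun ρ : V → Fin 3 => ρ u = 0 ∧ ρ v = 1),
        (if ∀ t ∈ T, ρ t = 0 then g (((K.peelContract y S u).contractOne s' u).ctypeM ρ) (ρ s) else 0)
          = (fun σ => if ∀ t ∈ T, σ t = 0 then g ((K.peelContract y S u).ctypeM σ) (σ s) else 0) (Function.update ρ s' 0) := by
      intro ρ hρ
      have hu0 : ρ u = 0 := ((mem_filter.1 hρ).2).1
      have hiff : (∀ t ∈ T, ρ t = 0) ↔ (∀ t ∈ T, Function.update ρ s' 0 t = 0) := by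
        constructor
        · intro h t ht; rw [Function.update_of_ne (show t ≠ s' from fun e => hsT (e ▸ ht))]; exact h t ht
        · intro h t ht; have := h t ht; rwa [Function.update_of_ne (show t ≠ s' from fun e => hsT (e ▸ ht))] at this
      simp only
      rw [(K.peelContract y S u).ctypeM_contractOne s' u hsu ρ hu0, Function.update_of_ne hss.symm]
      exact if_congr hiff rfl rfl
    rw [sum_congr rfl step1,
      sum_update_eq_three_mul s' u v hsu.symm hsv.symm (fun σ => if ∀ t ∈ T, σ t = 0 then g ((K.peelContract y S u).ctypeM σ) (σ s) else 0)]
    have step2 : ∀ ρ ∈ univ.filter (fun ρ : V → Fin 3 => ρ u = 0 ∧ ρ v = 1),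
        (if ρ s' = 0 then (fun σ => if ∀ t ∈ T, σ t = 0 then g ((K.peelContract y S u).ctypeM σ) (σ s) else 0) ρ else 0)
          = (if ∀ t ∈ insert s' T, ρ t = 0 then g ((K.peelContract y S u).ctypeM ρ) (ρ s) else 0) := by
      intro ρ _
      simp only
      by_cases h0 : ρ s' = 0
      · rw [if_pos h0]
        refine if_congr ?_ rfl rfl
        constructor
        · intro h t ht
          exact (mem_insert.1 ht).elim (fun e => by rw [e, h0]) (fun ht' => h t ht')
        · intro h t ht; exact h t (mem_insert_of_mem ht)
      · rw [if_neg h0, if_neg (fun h => h0 (h s' (mem_insert_self s' T)))]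
    rw [sum_congr rfl step2, ih huS' hyS' hvS' hsS' (insert s' T) hST, ← mul_assoc, mul_comm (3 : ℤ) ((3 : ℤ) ^ S.card)]
    congr 1
    refine sum_congr rfl fun ρ _ => if_congr ?_ rfl rfl
    constructor
    · intro h t ht
      rcases mem_union.1 ht with h1 | h1
      · rcases mem_insert.1 h1 with e | h2
        · exact h t (mem_union_right _ (by rw [e]; exact mem_insert_self s' T))
        · exact h t (mem_union_left _ h2)
      · exact h t (mem_union_right _ (mem_insert_of_mem h1))
    · intro h t ht
      rcases mem_union.1 ht with h1 | h1
      · exact h t (mem_union_left _ (mem_insert_of_mem h1))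
      · rcases mem_insert.1 h1 with e | h2
        · exact h t (mem_union_left _ (by rw [e]; exact mem_insert_self s' S))
        · exact h t (mem_union_right _ h2)

/-- **`s` far (`s ∉ S`)**: `3^{|S|}·AZW = TI(K.peelContract y S u)` — the weighted functional of the contracted graph. [this work] -/
theorem pow_mul_AZW_eq_TIfun (c : Fin 3) (y u v s : V) (S : Finset V) (huy : u ≠ y) (huS : u ∉ S) (hyS : y ∉ S) (hvS : v ∉ S) (hsS : s ∉ S) :
    3 ^ S.card * K.AZW c y S s u v = (K.peelContract y S u).TIfun c s u v := by
  have h := K.sum_peelContract_eq_col (hWt c) y u s S huy huS hyS v hvS hsS ∅ (disjoint_empty_right S)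
  unfold TIfun AZW
  rw [union_empty] at h
  rw [← h]
  refine sum_congr rfl fun ρ _ => ?_
  rw [if_pos (fun t ht => absurd ht (notMem_empty t))]

/-- **`s` near, weight at `u` (`s ∈ S`, `c = 0`)**: the weighted all-`0` sum is the all-`0` sum of `K⁺ᵘ`, so `3^{|S|}·AZW = T((K⁺ᵘ).peelContract y S u)`
(the special vertex is merged into `u` and always carries `u`'s colour). [this work] -/
theorem pow_mul_AZW_eq_of_mem_zero (y u v s : V) (S : Finset V) (huy : u ≠ y) (huS : u ∉ S) (hyS : y ∉ S) (hvS : v ∉ S) (hsS : s ∈ S) :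
    3 ^ S.card * K.AZW 0 y S s u v = ((K.addMark u 1).peelContract y S u).TfunM u v := by
  rw [(K.addMark u 1).TfunM_peelContract y u v S huy huS hyS hvS]
  congr 1
  unfold AZW allZeroSum
  refine sum_congr rfl fun ρ hρ => ?_
  obtain ⟨hu, -⟩ := (mem_filter.1 hρ).2
  by_cases h : ∀ s' ∈ S, ρ s' = 0
  · rw [if_pos h, if_pos h, K.isolate_addMark u y huy 1, (K.isolate y).ctypeM_addMark u 1 ρ, hu, cap3_one_triple]
    unfold hWt
    rw [if_pos (h s hsS)]
  · rw [if_neg h, if_neg h]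

/-- **`s` near, weight at `v` (`s ∈ S`, `c = 1`)**: the merged special vertex carries `u`'s colour, never the weight colour: `3^{|S|}·AZW = 2·T(K.peelContract y S u)`.
[this work] -/
theorem pow_mul_AZW_eq_of_mem_one (y u v s : V) (S : Finset V) (huy : u ≠ y) (huS : u ∉ S) (hyS : y ∉ S) (hvS : v ∉ S) (hsS : s ∈ S) :
    3 ^ S.card * K.AZW 1 y S s u v = 2 * (K.peelContract y S u).TfunM u v := by
  rw [K.TfunM_peelContract y u v S huy huS hyS hvS, mul_left_comm]
  congr 1
  unfold AZW allZeroSum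
  rw [mul_sum]
  refine sum_congr rfl fun ρ _ => ?_
  by_cases h : ∀ s' ∈ S, ρ s' = 0
  · rw [if_pos h, if_pos h]
    unfold hWt
    rw [if_neg (by rw [h s hsS]; decide)]
  · rw [if_neg h, if_neg h, mul_zero]

end WContract

/-! ## The marked-vertex case and the degree-0 identity -/

section Pointwise

/-- **A MARKED NON-TERMINAL `y ≠ s` IS DELETED MONOTONICALLY** (memo §9 (a)): `TI(K.isolate y) ≤ 3·TI(K)` for both weight colours — every weighted
one-point kernel value is nonnegative when no profile coordinate vanishes. [this work] -/
theorem TIfun_isolate_le_of_mark (c : Fin 3) (y s u v : V) (hys : y ≠ s) (hyu : y ≠ u) (hyv : y ≠ v) (hmark : K.mark y ≠ 0) :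
    (K.isolate y).TIfun c s u v ≤ 3 * K.TIfun c s u v := by
  have h := K.sum_WK_eq (c := c) hys hyu hyv
  have hnn : 0 ≤ ∑ ρ ∈ univ.filter (fun ρ : V → Fin 3 => ρ u = 0 ∧ ρ v = 1), K.WK c y s ρ := by
    refine sum_nonneg fun ρ _ => ?_
    rw [K.WK_eq ρ]
    have h1 : (K.profM y ρ).1 ≠ 0 := cap3_ne_zero (by omega)
    have h2 : (K.profM y ρ).2.1 ≠ 0 := cap3_ne_zero (by omega)
    have h3 : (K.profM y ρ).2.2 ≠ 0 := cap3_ne_zero (by omega)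
    split_ifs
    · exact kerTAbs_nonneg_of_ne_zero _ _ h1 h2 h3
    · exact mul_nonneg (by norm_num) (kerTAbs_nonneg_of_ne_zero _ _ h1 h2 h3)
  linarith

/-- **THE DEGREE-0 IDENTITY** (memo §9 (e), `N(y) ⊆ {u,v}`): for an unmarked non-terminal `y ≠ s`, with `A = mul y u`, `B = mul y v` and no other
neighbour, `3·TI(K) = TI(K') + TI(K' + A marks at u) + TI(K' + B marks at v)` where `K' = K.isolate y` (`c ∈ {0,1}`): the colour of `y` makes exactly the
members through the like-coloured terminal monochromatic (any weight colour `c`). [this work] -/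
theorem three_mul_TIfun_eq_of_pendant (c : Fin 3) (y s u v : V) (huv : u ≠ v) (hys : y ≠ s) (hyu : y ≠ u) (hyv : y ≠ v)
    (hmark : K.mark y = 0) (hnone : ∀ w, w ≠ u → w ≠ v → K.mul y w = 0) :
    3 * K.TIfun c s u v = (K.isolate y).TIfun c s u v + ((K.isolate y).addMark u (K.mul y u)).TIfun c s u v
      + ((K.isolate y).addMark v (K.mul y v)).TIfun c s u v := by
  have h := K.sum_WK_eq (c := c) hys hyu hyv
  have hprof : ∀ ρ : V → Fin 3, ρ u = 0 → ρ v = 1 → K.profM y ρ = (cap3 (K.mul y u), cap3 (K.mul y v), 0) := by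
    intro ρ hu hv
    have hl : ∀ d, K.linkM y ρ d = (if (0 : Fin 3) = d then K.mul y u else 0) + (if (1 : Fin 3) = d then K.mul y v else 0) := by
      intro d
      unfold linkM
      rw [← Finset.sum_erase_add _ _ (mem_univ u), ← Finset.sum_erase_add _ _ (mem_erase.2 ⟨huv.symm, mem_univ v⟩), hu, hv]
      have hz : ∑ w ∈ (univ.erase u).erase v, (if ρ w = d then K.mul y w else 0) = 0 :=
        sum_eq_zero fun w hw => by
          have hwv : w ≠ v := (mem_erase.1 hw).1
          have hwu : w ≠ u := (mem_erase.1 (mem_erase.1 hw).2).1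
          rw [hnone w hwu hwv]; simp
      rw [hz, zero_add, add_comm]
    unfold profM
    rw [hl 0, hl 1, hl 2, hmark]
    simp
    rfl
  have hsum : ∑ ρ ∈ univ.filter (fun ρ : V → Fin 3 => ρ u = 0 ∧ ρ v = 1), K.WK c y s ρ
      = ((K.isolate y).addMark u (K.mul y u)).TIfun c s u v + ((K.isolate y).addMark v (K.mul y v)).TIfun c s u v := by
    unfold TIfun
    rw [← sum_add_distrib]
    refine sum_congr rfl fun ρ hρ => ?_
    obtain ⟨hu, hv⟩ := (mem_filter.1 hρ).2
    rw [K.WK_eq ρ, hprof ρ hu hv, (K.isolate y).ctypeM_addMark u _ ρ, (K.isolate y).ctypeM_addMark v _ ρ, hu, hv, xPart_zero_diag, xPart_one_diag]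
    unfold hWt
    by_cases hsc : ρ s = c
    · simp only [if_pos hsc]
      rw [kerTAbs_profile_no_two, ctAdd_right_comm _ (xPart c _) (cap3 (K.mul y u), 0, 0), ctAdd_right_comm _ (xPart c _) (0, cap3 (K.mul y v), 0)]
    · simp only [if_neg hsc]
      rw [kerTAbs_profile_no_two]
      ring
  linarith

end Pointwise

end MGraph

end Summit.CriticalPhenomena.PercolationContinuityZ3.Theorems.SunflowerPartition.Kempe
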